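import Literature.AlgebraicGeometry.Pohlmann1968.DivisorClassesCMAlgebra
import Literature.AlgebraicGeometry.HodgeTheory.AlgebraicClassesCupAbelianVarietyDiagonal
import HarnessLib

/-!
# Weight lines of a product of CM abelian varieties are multiplicative: the line of a disjoint union of weights is
# the cup product of the lines, so it is algebraic when they are

COR-CM (cell `pub-hodgecm2`), seat b30 gen 14 (2026-08-21); count-neutral; theorems only, no definition, no named fact,
no `sorry`.  A general dictionary entry for Pohlmann's weights on `B = ⨁_j A_j` (CM algebra `∏_j K_j`, the tree's
`Pohlmann1968.weightClassesAlg`), complementing `CorCM/DihedralSexticPairWeights.lean`: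

* `cupMonomial_eq_smul_cupProduct_of_eq_disjUnion` — in the eigen-monomial basis, `w_{S ⊔ T} = ± w_S ⌣ w_T` read in the
  degree `2p`, `p = a + b` (the tree's `cupMonomial_disjUnion_eq_smul_cup` with the degree cast absorbed);
* **`weightClassesAlg_union_le_algebraicClasses`** — if the weight lines `H^{2a}(B)_S` and `H^{2b}(B)_T` of two
  DISJOINT weights consist of algebraic classes, so does `H^{2(a+b)}(B)_{S ⊔ T}`: the lines are spanned by the
  monomials (`Pohlmann1968.weightClassesAlg_eq_span_singleton`), and cup products of algebraic classes on an abelian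
  variety are algebraic (the tree's `AbelianVariety.cupProduct_mem_algebraicClasses'`, Voisin II Prop. 9.20 via the
  diagonal);
So the Hodge conjecture for a CM product reduces, weight by weight, to the algebraicity of the lines of a set of
«generating» weights of which every Galois-balanced weight is a disjoint union (kernel censuses of the cell:
`Census/DihedralSexticPair.lean`, …).  [cite: Milne2020HodgeClassesAV, 1.2 (a)] [cite: vanGeemen1994HodgeAV, §2.4]
[cite: VoisinHodgeII2003, Prop. 9.20]

## References
* [Milne2020HodgeClassesAV] J. S. Milne, arXiv:2010.08857, 1.2 (a).
* [vanGeemen1994HodgeAV] B. van Geemen, LNM 1594 (1994), §2.4.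
* [VoisinHodgeII2003] C. Voisin, *Hodge Theory and Complex Algebraic Geometry II*, Prop. 9.20.
-/

noncomputable section

open CategoryTheory CategoryTheory.Limits NumberField

namespace Summit.HodgeConjecture.CorCM.PairWeights

open Literature.AlgebraicGeometry Literature.AlgebraicGeometry.Motives Literature.AlgebraicGeometry.HodgeTheory
open Literature.AlgebraicGeometry.ComplexMultiplication (IsCMTypeRealisation)
open Literature.AlgebraicGeometry.Pohlmann1968
open Literature.AlgebraicTopology.SingularHomology

open scoped Classical

/-! ## §1 Monomials of disjoint unions, with the degree cast absorbed -/

section Monomials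

variable {Y : Type} [TopologicalSpace Y] {I : Type*} [LinearOrder I] (v : I → singularCohomology ℂ ℂ Y 1)

/-- `v_u = ± v_s ⌣ v_t` for `u = s ⊔ t` read in ANY degree `n` with `m + m' = n` (the tree's
`cupMonomial_disjUnion_eq_smul_cup` after substituting the degree). [cite: HatcherAT2002, §3.2 Example 3.16] -/
theorem cupMonomial_eq_smul_cupProduct_of_eq_disjUnion {m m' n : ℕ} (h : m + m' = n) (s : Set.powersetCard I m)
    (t : Set.powersetCard I m') (hst : Disjoint s.val t.val) (u : Set.powersetCard I n)
    (hu : (u : Finset I) = Finset.disjUnion s.val t.val hst) :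
    ∃ ε : ℤˣ, cupMonomial v n u = (ε : ℤ) • cupProduct h (cupMonomial v m s) (cupMonomial v m' t) := by
  subst h
  have hu' : u = Set.powersetCard.disjUnion hst := Subtype.ext hu
  refine ⟨(Set.powersetCard.permOfDisjoint hst).sign, ?_⟩
  rw [hu', cupMonomial_disjUnion_eq_smul_cup v s t hst, Units.smul_def]

end Monomials

/-! ## §2 The line of a disjoint union of weights with algebraic lines is algebraic -/

section Union

variable {n : ℕ} {K : Fin n → Type} [∀ i, Field (K i)] [∀ i, NumberField (K i)]
  {A : Fin n → AbelianVariety ℂ} {Φ : ∀ i, CMType (K i)} {ι : ∀ i, 𝓞 (K i) →+* End (A i)}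
  {θ : ∀ i, K i →+* Module.End ℂ (complexBetti (A i).X 1)}

/-- **Multiplicativity of algebraic weight lines**: for DISJOINT weights `S` (`|S| = 2a`) and `T` (`|T| = 2b`) on
`B = ⨁_j A_j` whose weight lines consist of algebraic classes, the weight line of `S ⊔ T` (degree `2p`, `p = a + b`)
consists of algebraic classes — it is spanned by the monomial `w_{S ⊔ T} = ± w_S ⌣ w_T`, a cup product of
algebraic classes on the abelian variety `B`.  Stated with `Finset.disjUnion` (rewrite with `Finset.disjUnion_eq_union`
in the consumer's decidability instance). [cite: Milne2020HodgeClassesAV, 1.2 (a)] [cite: VoisinHodgeII2003, Prop. 9.20] -/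
theorem weightClassesAlg_union_le_algebraicClasses (hA : ∀ i, IsCMTypeRealisation (Φ i) (A i) (ι i) (θ i))
    {a b p : ℕ} (hp : a + b = p) {S T : Finset ((i : Fin n) × (K i →+* ℂ))} (hS : S.card = 2 * a)
    (hT : T.card = 2 * b) (hST : Disjoint S T)
    (hSalg : weightClassesAlg A ι (2 * a) S ≤ algebraicClasses (⨁ A).X a)
    (hTalg : weightClassesAlg A ι (2 * b) T ≤ algebraicClasses (⨁ A).X b) :
    weightClassesAlg A ι (2 * p) (S.disjUnion T hST) ≤ algebraicClasses (⨁ A).X p := by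
  subst hp
  letI : LinearOrder ((i : Fin n) × (K i →+* ℂ)) :=
    LinearOrder.lift' (Fintype.equivFin _) (Fintype.equivFin _).injective
  obtain ⟨w, hw, -, -⟩ := exists_eigenbasis_biproduct hA
  obtain ⟨bS, hbS'⟩ := exists_monomialBasis w (2 * a)
  obtain ⟨bT, hbT'⟩ := exists_monomialBasis w (2 * b)
  obtain ⟨bU, hbU'⟩ := exists_monomialBasis w (2 * (a + b))
  have hbS : ∀ s, bS s = cupMonomial w (2 * a) s := hbS'
  have hbT : ∀ s, bT s = cupMonomial w (2 * b) s := hbT'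
  have hbU : ∀ s, bU s = cupMonomial w (2 * (a + b)) s := hbU'
  have hU : (S.disjUnion T hST).card = 2 * (a + b) := by rw [Finset.card_disjUnion, hS, hT]; ring
  set uS : Set.powersetCard ((i : Fin n) × (K i →+* ℂ)) (2 * a) := Set.powersetCard.ofCard hS with huS
  set uT : Set.powersetCard ((i : Fin n) × (K i →+* ℂ)) (2 * b) := Set.powersetCard.ofCard hT with huT
  set uU : Set.powersetCard ((i : Fin n) × (K i →+* ℂ)) (2 * (a + b)) := Set.powersetCard.ofCard hU with huU
  -- the three lines are spanned by the monomials
  have hlineU : weightClassesAlg A ι (2 * (a + b)) (S.disjUnion T hST) = ℂ ∙ bU uU :=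
    weightClassesAlg_eq_span_singleton hw hbU uU
  have hmemS : bS uS ∈ algebraicClasses (⨁ A).X a := by
    apply hSalg
    rw [show S = (uS : Finset ((i : Fin n) × (K i →+* ℂ))) from rfl, weightClassesAlg_eq_span_singleton hw hbS uS]
    exact Submodule.mem_span_singleton_self _
  have hmemT : bT uT ∈ algebraicClasses (⨁ A).X b := by
    apply hTalg
    rw [show T = (uT : Finset ((i : Fin n) × (K i →+* ℂ))) from rfl, weightClassesAlg_eq_span_singleton hw hbT uT]
    exact Submodule.mem_span_singleton_self _
  -- `w_{S ⊔ T} = ± w_S ⌣ w_T`, algebraic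
  have hdisj : Disjoint uS.val uT.val := hST
  obtain ⟨ε, hε⟩ := cupMonomial_eq_smul_cupProduct_of_eq_disjUnion w (two_mul_add_two_mul a b) uS uT hdisj uU rfl
  have hmemU : bU uU ∈ algebraicClasses (⨁ A).X (a + b) := by
    rw [hbU uU, hε, ← hbS uS, ← hbT uT, ← Int.cast_smul_eq_zsmul ℂ]
    exact Submodule.smul_mem _ _ (AbelianVariety.cupProduct_mem_algebraicClasses' (⨁ A) _ hmemS hmemT)
  rw [hlineU]
  exact (Submodule.span_singleton_le_iff_mem _ _).2 hmemU

end Union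

end Summit.HodgeConjecture.CorCM.PairWeights

end
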